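import Literature.AlgebraicGeometry.Motives.MumfordTateLieAlgebraWeights
import HarnessLib

/-!
# Hodge structures whose Mumford–Tate group has dimension `≤ 3`: the Mumford–Tate Lie algebra consists of
# Hodge endomorphisms, is abelian, and the commutant of `End_Hdg(V)` is commutative

Family `hodge`, layer `Literature/AlgebraicGeometry/Motives`; THEOREMS ONLY (no definition, no named fact;
D-0026).  Abstract companion (pure `ℚ`-Hodge structures) of the cell `pub-hodgecm2` (COR-CM) lane MT-RANK-THREE,
whose geometric file `Summits/HodgeConjecture/CorCM/MumfordTateRankThree.lean` reads the results below on `H¹` of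
a complex abelian variety («`dim MT(H¹(X)) ≤ 3` ⟹ `X` is of CM type»).  Sequel of `Motives/MumfordTateRankTwo`
(`dim MT ≤ 2`); the linear algebra (weights of `ad Θ`, conjugation symmetry, Lie closure, `dim_ℂ 𝔪𝔱_ℂ ≤ dim_ℚ 𝔪𝔱`)
is in `Motives/MumfordTateLieAlgebraWeights`.

Let `H` be a pure `ℚ`-Hodge structure of weight `n ≠ 0` on a finite-dimensional `V`, `𝔪𝔱 = H.mumfordTateLieAlgebra`
(`dim_ℚ 𝔪𝔱 = H.mtRank = dim MT(H)`), `End_Hdg(V) = H.endAlg`, `Θ` the grading operator of a graded basis adapted to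
`H`, `𝔪𝔱_ℂ = span_ℂ {X_ℂ | X ∈ 𝔪𝔱}`.

* §5 **`four_le_mtRank_of_not_mem_endAlg` — if some `X ∈ 𝔪𝔱` is NOT a Hodge endomorphism then
  `dim MT(H) ≥ 4`**: `id, Θ, [Θ, X_ℂ], [Θ, [Θ, X_ℂ]] ∈ 𝔪𝔱_ℂ` are linearly independent — a linear relation kills,
  entry by entry, every root component of `X_ℂ` of weight `k ≠ 0` except for at most one weight `k₀`, and then
  the components of weight `−k₀` vanish, hence (conjugation symmetry, `X` being rational) those of weight `k₀`
  too, so `X_ℂ` would be of weight `0`, i.e. a Hodge endomorphism.  Equivalently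
  **`mumfordTateLieAlgebra_le_endAlg_of_mtRank_le_three`: if `dim MT(H) ≤ 3` then `𝔪𝔱 ⊆ End_Hdg(V)`**.
* §6 consequences for `dim MT(H) ≤ 3` (and, more generally, whenever `𝔪𝔱 ⊆ End_Hdg(V)`): `𝔪𝔱` is central in
  `End_Hdg(V)` (`commute_of_mem_lieStabilizer`: `𝔪𝔱` commutes with every Hodge endomorphism), hence
  **`𝔪𝔱` is abelian** (`commute_of_mem_mumfordTateLieAlgebra_of_le_endAlg`, `…_of_mtRank_le_three`), and **the
  commutant of `End_Hdg(V)` in `End_ℚ V` consists of Hodge endomorphisms and is commutative**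
  (`mem_endAlg_of_forall_commute_endAlg`, `commute_of_forall_commute_endAlg(_of_mtRank_le_three)`; through the
  tree's `mem_endAlg_of_forall_commute`: an endomorphism commuting with `Lie Hdg ⊆ 𝔪𝔱` is a Hodge endomorphism).
  On `H¹` of an abelian variety the last statement is the hypothesis of the tree's CM criterion
  `isOfCMType_of_centralizer_bettiCohomology_comm` (Deligne I 5.1 / Milne 1999 Rem. 1.10).

This is the Lie-algebra shadow of the classical equivalence «`V` is a CM-Hodge structure ⟺ `M` is an algebraic
torus ⟺ `M(ℚ) ⊆ End(V, φ)`» (Green–Griffiths–Kerr, Ch. V, p. 20 and (V.2)–(V.3)) in the low-rank range where it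
is automatic: a non-abelian reductive Mumford–Tate group has a semisimple part of dimension `≥ 3` besides the
homotheties, so `dim ≥ 4` (attained by `GL₂ = MT(H¹(E))`, `E` a non-CM elliptic curve); the proof given here
needs neither reductivity nor the structure theory of semisimple Lie algebras, only the conjugation symmetry of
the `ad Θ`-weights.

## References

* [Deligne1982HodgeCycles] P. Deligne, *Hodge cycles on abelian varieties*, LNM 900 (1982), I §3, Prop. 3.4 (and
  its proof: `μ(𝔾ₘ) ⊆ MT_ℂ`), Ex. 3.7; I §5, Prop. 5.1.
* [GreenGriffithsKerr2012] M. Green, P. Griffiths, M. Kerr, *Mumford–Tate Groups and Domains* (2012), I.B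
  (I.B.1)–(I.B.5); Ch. V, p. 20 and Props. (V.2), (V.3) (CM Hodge structures: `M` a torus ⟺ `M(ℚ) ⊆ End(V, φ)`).
* [MoonenZarhin1999LowDim] B. Moonen, Yu. Zarhin, *Hodge classes on abelian varieties of low dimension*, Math. Ann.
  315 (1999), §2 (`X` of CM type iff `Hg(X)` is commutative).
* [Huybrechts2016K3] D. Huybrechts, *Lectures on K3 Surfaces* (2016), §3.3.3–3.3.4 (`End_Hdg`, the commutant of
  `Lie Hdg`).
-/

noncomputable section

open scoped TensorProduct

namespace Literature.AlgebraicGeometry.Motives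

universe u

namespace HodgeStructure

variable {V : Type u} [AddCommGroup V] [Module ℚ V] [Module.Finite ℚ V] [HodgeTensorFacts.{u, u}] {n : ℤ}


/-! ## §5 `dim MT(H) ≤ 3` forces `𝔪𝔱 ⊆ End_Hdg(V)` -/

/-- **If some `X ∈ 𝔪𝔱` is not a Hodge endomorphism then `dim MT(H) ≥ 4`** (`n ≠ 0`).  In a graded basis adapted to
`H`, `X_ℂ` has a non-zero entry of some weight `k ≠ 0` (§2).  The four elements `id, Θ, Z = [Θ, X_ℂ],
Z' = [Θ, Z]` of `𝔪𝔱_ℂ` (`id ∈ 𝔪𝔱` as `n ≠ 0`, `Θ ∈ 𝔪𝔱_ℂ` by Deligne's `μ(𝔾ₘ) ⊆ MT_ℂ`, and `𝔪𝔱_ℂ` is a Lie algebra)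
are linearly independent, whence `4 ≤ dim_ℂ 𝔪𝔱_ℂ ≤ dim_ℚ 𝔪𝔱`: a relation `α id + β Θ + γ Z + δ Z' = 0` reads, entry
by entry, `α + β deg τ = 0` on the diagonal (so `α = β = 0`, two degrees occurring) and
`(γ + δ m) (X_ℂ)_{στ} = 0` off it, `m = deg σ − deg τ ≠ 0`; so `γ + δ k = 0`, hence `γ − δ k ≠ 0` and all entries
of weight `−k` vanish — but then (§3, `X` is rational) all entries of weight `k` vanish, a contradiction.
[cite: Deligne1982HodgeCycles, I Prop. 3.4 (proof) and Ex. 3.7] [cite: GreenGriffithsKerr2012, Ch. V (V.2)–(V.3)] -/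
theorem four_le_mtRank_of_not_mem_endAlg (H : HodgeStructure V n) (hn : n ≠ 0) {X : Module.End ℚ V}
    (hX : X ∈ H.mumfordTateLieAlgebra) (hXE : X ∉ H.endAlg) : 4 ≤ H.mtRank := by
  classical
  obtain ⟨S, deg, e, hF, hFc⟩ := exists_basis_F_eq_span H
  haveI : Fintype S := FiniteDimensional.fintypeBasisIndex e
  -- a non-zero entry of non-zero weight
  obtain ⟨σ₀, τ₀, hdeg, hE⟩ : ∃ σ τ : S, deg σ ≠ deg τ ∧ e.repr (X.baseChange ℂ (e τ)) σ ≠ 0 := by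
    by_contra hcon
    push Not at hcon
    exact hXE (mem_endAlg_of_repr_baseChange_eq_zero H e hF fun σ τ hστ => hcon σ τ hστ)
  set L := H.mumfordTateLieAlgebra with hL
  set M : Submodule ℂ (Module.End ℂ (ℂ ⊗[ℚ] V)) := Submodule.span ℂ
    ((fun X : Module.End ℚ V => X.baseChange ℂ) '' (L : Set (Module.End ℚ V))) with hM
  set Θ : Module.End ℂ (ℂ ⊗[ℚ] V) := gradingEnd e deg with hΘ
  set Y : Module.End ℂ (ℂ ⊗[ℚ] V) := X.baseChange ℂ with hY
  set Z : Module.End ℂ (ℂ ⊗[ℚ] V) := Θ * Y - Y * Θ with hZ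
  set Z' : Module.End ℂ (ℂ ⊗[ℚ] V) := Θ * Z - Z * Θ with hZ'
  -- the four elements of `𝔪𝔱_ℂ`
  have hΘM : Θ ∈ M := gradingEnd_mem_span_baseChange_mumfordTateLieAlgebra H e hF hFc
  have hidM : (LinearMap.id : Module.End ℂ (ℂ ⊗[ℚ] V)) ∈ M := by
    have h : (LinearMap.id : Module.End ℚ V).baseChange ℂ ∈ M :=
      Submodule.subset_span ⟨LinearMap.id, H.id_mem_mumfordTateLieAlgebra hn, rfl⟩
    rwa [LinearMap.baseChange_id] at h
  have hYM : Y ∈ M := Submodule.subset_span ⟨X, hX, rfl⟩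
  have hZM : Z ∈ M := commutator_mem_span_baseChange_mumfordTateLieAlgebra H hΘM hYM
  have hZ'M : Z' ∈ M := commutator_mem_span_baseChange_mumfordTateLieAlgebra H hΘM hZM
  let v : Fin 4 → Module.End ℂ (ℂ ⊗[ℚ] V) := ![LinearMap.id, Θ, Z, Z']
  have hv : ∀ i, v i ∈ M := by
    intro i
    fin_cases i
    · exact hidM
    · exact hΘM
    · exact hZM
    · exact hZ'M
  by_cases hli : LinearIndependent ℂ v
  · -- `4 ≤ dim_ℂ 𝔪𝔱_ℂ ≤ dim_ℚ 𝔪𝔱`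
    have hli' : LinearIndependent ℂ (fun i => (⟨v i, hv i⟩ : M)) :=
      LinearIndependent.of_comp M.subtype (by exact hli)
    have h4 : 4 ≤ Module.finrank ℂ M := by
      have h := hli'.fintype_card_le_finrank
      rwa [Fintype.card_fin] at h
    exact h4.trans (finrank_span_baseChange_le_mtRank H)
  · exfalso
    obtain ⟨g, hg, i₀, hi₀⟩ := Fintype.not_linearIndependent_iff.1 hli
    have hg' : g 0 • (LinearMap.id : Module.End ℂ (ℂ ⊗[ℚ] V)) + g 1 • Θ + g 2 • Z + g 3 • Z' = 0 := by
      simpa [Fin.sum_univ_four, v] using hg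
    -- the entries of the relation
    have hentry : ∀ σ τ : S,
        g 0 * (Finsupp.single τ (1 : ℂ) σ) + g 1 * ((deg σ : ℂ) * Finsupp.single τ (1 : ℂ) σ) +
          g 2 * (((deg σ : ℂ) - deg τ) * e.repr (Y (e τ)) σ) +
          g 3 * (((deg σ : ℂ) - deg τ) * (((deg σ : ℂ) - deg τ) * e.repr (Y (e τ)) σ)) = 0 := by
      intro σ τ
      have h := congrArg (fun T : Module.End ℂ (ℂ ⊗[ℚ] V) => e.repr (T (e τ)) σ) hg'
      simp only [LinearMap.add_apply, LinearMap.smul_apply, LinearMap.zero_apply, LinearMap.id_apply, map_add,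
        map_smul, map_zero, Finsupp.coe_add, Finsupp.coe_smul, Finsupp.coe_zero, Pi.add_apply, Pi.smul_apply,
        Pi.zero_apply, smul_eq_mul, hZ', hZ, hΘ, repr_commutator_gradingEnd_apply_basis, repr_gradingEnd_apply,
        Module.Basis.repr_self] at h
      exact h
    -- diagonal entries: `g 0 + g 1 * deg τ = 0`
    have hdiag : ∀ τ : S, g 0 + g 1 * (deg τ : ℂ) = 0 := by
      intro τ
      have h := hentry τ τ
      simp only [Finsupp.single_eq_same, sub_self, zero_mul, mul_zero, add_zero, mul_one] at h
      linear_combination h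
    have hg1 : g 1 = 0 := by
      have h : g 1 * ((deg σ₀ : ℂ) - deg τ₀) = 0 := by linear_combination hdiag σ₀ - hdiag τ₀
      rcases mul_eq_zero.1 h with h1 | h1
      · exact h1
      · exact absurd (Int.cast_injective (sub_eq_zero.1 h1)) hdeg
    have hg0 : g 0 = 0 := by
      have h := hdiag τ₀
      rw [hg1, zero_mul, add_zero] at h
      exact h
    -- off-diagonal entries: `(g 2 + g 3 * m) * Y_{στ} = 0` for `m = deg σ - deg τ ≠ 0`
    have hoff : ∀ σ τ : S, deg σ ≠ deg τ →
        (g 2 + g 3 * ((deg σ : ℂ) - deg τ)) * e.repr (Y (e τ)) σ = 0 := by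
      intro σ τ hστ
      have hne : σ ≠ τ := fun h => hστ (by rw [h])
      have hm : ((deg σ : ℂ) - deg τ) ≠ 0 := sub_ne_zero.2 fun h => hστ (Int.cast_injective h)
      have h := hentry σ τ
      rw [Finsupp.single_eq_of_ne hne, mul_zero, mul_zero, mul_zero, zero_add, zero_add] at h
      have h' : ((deg σ : ℂ) - deg τ) * ((g 2 + g 3 * ((deg σ : ℂ) - deg τ)) * e.repr (Y (e τ)) σ) = 0 := by
        linear_combination h
      exact (mul_eq_zero.1 h').resolve_left hm
    -- the weight `k = deg σ₀ - deg τ₀` of the non-zero entry: `g 2 + g 3 * k = 0`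
    set k : ℂ := (deg σ₀ : ℂ) - deg τ₀ with hk
    have hk0 : k ≠ 0 := sub_ne_zero.2 fun h => hdeg (Int.cast_injective h)
    have hgk : g 2 + g 3 * k = 0 := by
      rcases mul_eq_zero.1 (hoff σ₀ τ₀ hdeg) with h | h
      · exact h
      · exact absurd h hE
    have hgk' : g 2 + g 3 * (-k) ≠ 0 := by
      intro h
      have hg2 : g 2 = 0 := by linear_combination (h + hgk) / 2
      have hg3 : g 3 = 0 := by
        have h3 : g 3 * k = 0 := by linear_combination hgk - hg2
        exact (mul_eq_zero.1 h3).resolve_right hk0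
      apply hi₀
      fin_cases i₀
      · exact hg0
      · exact hg1
      · exact hg2
      · exact hg3
    -- all entries of weight `-k` vanish, hence (conjugation) all entries of weight `k`: contradiction
    have hneg : ∀ σ τ : S, deg σ - deg τ = -(deg σ₀ - deg τ₀) → e.repr (Y (e τ)) σ = 0 := by
      intro σ τ hστ
      have hστ' : deg σ ≠ deg τ := by
        intro h
        rw [h, sub_self] at hστ
        exact hdeg (by omega)
      have hcast : ((deg σ : ℂ) - deg τ) = -k := by
        rw [hk]
        exact_mod_cast hστ
      have h := hoff σ τ hστ'
      rw [hcast] at h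
      exact (mul_eq_zero.1 h).resolve_left hgk'
    exact hE (repr_baseChange_apply_eq_zero_of_neg H e hF hFc X hneg σ₀ τ₀ rfl)

/-- **`dim MT(H) ≤ 3` ⟹ `𝔪𝔱 ⊆ End_Hdg(V)`** (`n ≠ 0`): every element of the Mumford–Tate Lie algebra is a Hodge
endomorphism (contrapositive of `four_le_mtRank_of_not_mem_endAlg`).  For `dim MT(H) ≤ 2` this is
`Motives/MumfordTateRankTwo` (`𝔪𝔱 = ℚ·id` or `ℚ·id ⊕ ℚ·x`, `x_ℂ` affine in `Θ`); `3` is the last value for which it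
is automatic (`GL₂ = MT(H¹(E))`, `E` a non-CM elliptic curve, has dimension `4`).
[cite: GreenGriffithsKerr2012, Ch. V p. 20 and (V.2)–(V.3)] [cite: Deligne1982HodgeCycles, I Prop. 3.4 and Ex. 3.7] -/
theorem mumfordTateLieAlgebra_le_endAlg_of_mtRank_le_three (H : HodgeStructure V n) (hn : n ≠ 0)
    (h3 : H.mtRank ≤ 3) : H.mumfordTateLieAlgebra ≤ Subalgebra.toSubmodule H.endAlg := by
  intro X hX
  rw [Subalgebra.mem_toSubmodule]
  by_contra hXE
  have h4 := four_le_mtRank_of_not_mem_endAlg H hn hX hXE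
  omega

/-! ## §6 Consequences: `𝔪𝔱` is central in `End_Hdg(V)`, abelian, and the commutant of `End_Hdg(V)` is commutative -/

/-- `𝔪𝔱` commutes with every Hodge endomorphism (the tree's `commute_of_mem_lieStabilizer`, in the
`mumfordTateLieAlgebra` spelling). [cite: Deligne1982HodgeCycles, I Prop. 3.4] -/
theorem commute_of_mem_mumfordTateLieAlgebra (H : HodgeStructure V n) {X : Module.End ℚ V}
    (hX : X ∈ H.mumfordTateLieAlgebra) {a : Module.End ℚ V} (ha : a ∈ H.endAlg) : X * a = a * X := by
  rw [mumfordTateLieAlgebra_eq_lieStabilizer] at hX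
  exact commute_of_mem_lieStabilizer H hX ⟨a, ha⟩

/-- **When `𝔪𝔱 ⊆ End_Hdg(V)`, `𝔪𝔱` lies in the CENTRE of `End_Hdg(V)`** (it commutes with all of `End_Hdg(V)`).
[cite: GreenGriffithsKerr2012, Ch. V (V.2)] -/
theorem mem_center_endAlg_of_le_endAlg (H : HodgeStructure V n)
    (hle : H.mumfordTateLieAlgebra ≤ Subalgebra.toSubmodule H.endAlg) {X : Module.End ℚ V}
    (hX : X ∈ H.mumfordTateLieAlgebra) :
    (⟨X, hle hX⟩ : H.endAlg) ∈ Subalgebra.center ℚ H.endAlg := by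
  rw [Subalgebra.mem_center_iff]
  intro a
  exact Subtype.ext (commute_of_mem_mumfordTateLieAlgebra H hX a.2).symm

/-- **When `𝔪𝔱 ⊆ End_Hdg(V)`, `𝔪𝔱` is ABELIAN**: `XY = YX` for `X, Y ∈ 𝔪𝔱` (`Y` is a Hodge endomorphism and `𝔪𝔱`
commutes with those) — the Mumford–Tate group is a torus. [cite: GreenGriffithsKerr2012, Ch. V p. 20]
[cite: MoonenZarhin1999LowDim, §2] -/
theorem commute_of_mem_mumfordTateLieAlgebra_of_le_endAlg (H : HodgeStructure V n)
    (hle : H.mumfordTateLieAlgebra ≤ Subalgebra.toSubmodule H.endAlg) {X Y : Module.End ℚ V}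
    (hX : X ∈ H.mumfordTateLieAlgebra) (hY : Y ∈ H.mumfordTateLieAlgebra) : X * Y = Y * X :=
  commute_of_mem_mumfordTateLieAlgebra H hX (hle hY)

/-- **When `𝔪𝔱 ⊆ End_Hdg(V)`, every endomorphism commuting with `End_Hdg(V)` is a Hodge endomorphism**: it
commutes with `Lie Hdg ⊆ 𝔪𝔱 ⊆ End_Hdg(V)`, and the commutant of `Lie Hdg` is `End_Hdg(V)`
(`mem_endAlg_of_forall_commute`: `Θ ∈ (Lie Hdg)_ℂ`). [cite: Huybrechts2016K3, §3.3.4 (p. 66)]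
[cite: Deligne1982HodgeCycles, I Prop. 3.4] -/
theorem mem_endAlg_of_forall_commute_endAlg (H : HodgeStructure V n)
    (hle : H.mumfordTateLieAlgebra ≤ Subalgebra.toSubmodule H.endAlg) {c : Module.End ℚ V}
    (hc : ∀ a ∈ H.endAlg, c * a = a * c) : c ∈ H.endAlg := by
  refine H.mem_endAlg_of_forall_commute fun X hX => hc X ?_
  have hX' : X ∈ H.mumfordTateLieAlgebra := by
    rw [mumfordTateLieAlgebra_eq_lieStabilizer]
    exact hodgeLie_le_lieStabilizer H hX
  exact hle hX'

/-- **When `𝔪𝔱 ⊆ End_Hdg(V)`, the commutant of `End_Hdg(V)` in `End_ℚ V` is COMMUTATIVE** (it consists of Hodge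
endomorphisms, `mem_endAlg_of_forall_commute_endAlg`, so any two of its elements commute) — on `H¹` of an abelian
variety this is the hypothesis «`C(A)` commutative» of Milne 1999 Rem. 1.10 / Deligne I 5.1.
[cite: Deligne1982HodgeCycles, I Prop. 5.1] [cite: GreenGriffithsKerr2012, Ch. V (V.2)] -/
theorem commute_of_forall_commute_endAlg (H : HodgeStructure V n)
    (hle : H.mumfordTateLieAlgebra ≤ Subalgebra.toSubmodule H.endAlg) {c c' : Module.End ℚ V}
    (hc : ∀ a ∈ H.endAlg, c * a = a * c) (hc' : ∀ a ∈ H.endAlg, c' * a = a * c') : c * c' = c' * c :=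
  hc c' (mem_endAlg_of_forall_commute_endAlg H hle hc')

/-- **`dim MT(H) ≤ 3` ⟹ `𝔪𝔱` is abelian** (`n ≠ 0`). [cite: GreenGriffithsKerr2012, Ch. V p. 20]
[cite: MoonenZarhin1999LowDim, §2] -/
theorem commute_of_mem_mumfordTateLieAlgebra_of_mtRank_le_three (H : HodgeStructure V n) (hn : n ≠ 0)
    (h3 : H.mtRank ≤ 3) {X Y : Module.End ℚ V} (hX : X ∈ H.mumfordTateLieAlgebra)
    (hY : Y ∈ H.mumfordTateLieAlgebra) : X * Y = Y * X :=
  commute_of_mem_mumfordTateLieAlgebra_of_le_endAlg H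
    (mumfordTateLieAlgebra_le_endAlg_of_mtRank_le_three H hn h3) hX hY

/-- **`dim MT(H) ≤ 3` ⟹ the commutant of `End_Hdg(V)` in `End_ℚ V` is commutative** (`n ≠ 0`).
[cite: Deligne1982HodgeCycles, I Prop. 5.1] [cite: GreenGriffithsKerr2012, Ch. V (V.2)–(V.3)] -/
theorem commute_of_forall_commute_endAlg_of_mtRank_le_three (H : HodgeStructure V n) (hn : n ≠ 0)
    (h3 : H.mtRank ≤ 3) {c c' : Module.End ℚ V} (hc : ∀ a ∈ H.endAlg, c * a = a * c)
    (hc' : ∀ a ∈ H.endAlg, c' * a = a * c') : c * c' = c' * c :=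
  commute_of_forall_commute_endAlg H (mumfordTateLieAlgebra_le_endAlg_of_mtRank_le_three H hn h3) hc hc'

/-! ## §7 `𝔪𝔱 ⊆ End_Hdg(V)` iff `𝔪𝔱` is abelian -/

/-- **An ABELIAN Mumford–Tate Lie algebra consists of Hodge endomorphisms**: an element of `𝔪𝔱` commuting with
`𝔪𝔱 ⊇ Lie Hdg` is a Hodge endomorphism, the commutant of `Lie Hdg` being `End_Hdg(V)`
(`mem_endAlg_of_forall_commute`: `Θ ∈ (Lie Hdg)_ℂ`).  No hypothesis on the weight.
[cite: GreenGriffithsKerr2012, Ch. V p. 20 and (V.2)–(V.3)] [cite: Huybrechts2016K3, §3.3.4 (p. 66)] -/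
theorem mumfordTateLieAlgebra_le_endAlg_of_comm (H : HodgeStructure V n)
    (hcomm : ∀ X ∈ H.mumfordTateLieAlgebra, ∀ Y ∈ H.mumfordTateLieAlgebra, X * Y = Y * X) :
    H.mumfordTateLieAlgebra ≤ Subalgebra.toSubmodule H.endAlg := by
  intro X hX
  rw [Subalgebra.mem_toSubmodule]
  refine H.mem_endAlg_of_forall_commute fun Y hY => hcomm X hX Y ?_
  rw [mumfordTateLieAlgebra_eq_lieStabilizer]
  exact hodgeLie_le_lieStabilizer H hY

/-- **`𝔪𝔱 ⊆ End_Hdg(V)` iff `𝔪𝔱` is abelian** (the Lie-algebra shadow of «`M(ℚ) ⊆ End(V, φ)` ⟺ `M` is a torus»,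
Green–Griffiths–Kerr Ch. V p. 20): `⟹` is `commute_of_mem_mumfordTateLieAlgebra_of_le_endAlg` (`𝔪𝔱` commutes with
`End_Hdg`), `⟸` is `mumfordTateLieAlgebra_le_endAlg_of_comm`. [cite: GreenGriffithsKerr2012, Ch. V p. 20 and (V.2)–(V.3)]
[cite: MoonenZarhin1999LowDim, §2] -/
theorem mumfordTateLieAlgebra_le_endAlg_iff_comm (H : HodgeStructure V n) :
    H.mumfordTateLieAlgebra ≤ Subalgebra.toSubmodule H.endAlg ↔
      ∀ X ∈ H.mumfordTateLieAlgebra, ∀ Y ∈ H.mumfordTateLieAlgebra, X * Y = Y * X :=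
  ⟨fun hle _ hX _ hY => commute_of_mem_mumfordTateLieAlgebra_of_le_endAlg H hle hX hY,
    mumfordTateLieAlgebra_le_endAlg_of_comm H⟩

end HodgeStructure

end Literature.AlgebraicGeometry.Motives

end
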